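import Literature.Topology.FourManifolds.TransportData
import HarnessLib

/-!
# Flip pairs of band-sum data

Topic `Literature/Topology/FourManifolds` (trunk T-4MAN). Fact seat
`provefact-Literature.Topology.FourManifolds.Knot.IsConnectedSum.isIsotopic` (Schubert's theorem),
geometric heart for rail knots. A **flip pair** is a pair of band-sum data `b₁` (of `(A₁, B₁, K₁)`)
and `b₂` (of `(A₂, B₂, K₂)`) with `b₁.band x = R (b₂.band ((1, 1) - x))` (`R = reflectLast 3`) and
the same collar width (`BandData.IsFlipPair`): transported data `b̃` of `b` (`TransportData.lean`)
form the flip pair `(b̃, b)` (`IsTransport.isFlipPair`), and the relation is symmetric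
(`IsFlipPair.symm`), so `(b, b̃)` is a flip pair as well. This file restates the crossing relations
of `TransportData.lean` for flip pairs (same proofs): the normal-position hypothesis transports
(`cross_eq`), `b₁.Fband q = sphereInv (b₂.Fband (-q))` (`Fband_eq`), `pZero`, frame vectors and
the frame relation `Ref (frame₂ Z) = frame₁ (-Z₀, -Z₁, μ Z₂)` (`refl_frame`), the transported
blow-up of an inverted point to first order (`exists_blowUp_sphereInv_near`); and adds the
**correspondence of necks**: `ψ⁻¹ (b₁.Fband q) = R (ψ⁻¹ (b₂.Fband (-q)))` (`psiN_symm_Fband_eq`), so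
the lower neck of `b₁` at level `α` is the reflected upper neck of `b₂` at level `-α` and vice
versa (`psiN_symm_railLoPsi_eq`, `psiN_symm_railHiPsi_eq`).

Everything is proved; no named facts are introduced.

## References

* J. M. Lee, *Introduction to Smooth Manifolds*, 2nd ed. (2012), Problem 1-7. [LeeSmoothManifolds2013]
-/

open scoped Manifold ContDiff Topology Real RealInnerProductSpace Matrix
open Function Set Metric Filter

noncomputable section

namespace Literature.Topology.FourManifolds

/-- Local notation: `𝔼 n` is the model Euclidean space `EuclideanSpace ℝ (Fin n)`. -/
local notation "𝔼 " n:arg => EuclideanSpace ℝ (Fin n)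

/-- Local notation: `𝕊 n` is the unit sphere in `EuclideanSpace ℝ (Fin (n + 1))`. -/
local notation "𝕊 " n:arg => (Metric.sphere (0 : EuclideanSpace ℝ (Fin (n + 1))) 1)

attribute [local instance] fact_finrank_euclideanSpace_succ

open KnotsInBall

namespace BandData

variable {A₁ B₁ K₁ : Knot} (b₁ : BandData A₁ B₁ K₁ ∅) {A₂ B₂ K₂ : Knot} (b₂ : BandData A₂ B₂ K₂ ∅)

/-! ### Flip pairs -/

/-- **Flip pairs**: `b₁.band x = R (b₂.band ((1, 1) - x))` and the same collar width. [folklore] -/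
structure IsFlipPair : Prop where
  band_eq : ∀ x, b₁.band x = reflectLast 3 (b₂.band (pt2 1 1 - x))
  δ_eq : b₁.δ = b₂.δ

variable {b₁ b₂}

/-- **Transported data form a flip pair** `(b̃, b)`. [folklore] -/
theorem IsTransport.isFlipPair {A B K : Knot} {b : BandData A B K ∅}
    {bt : BandData (B.map (reflectLastDiffeo 3)) (A.map (reflectLastDiffeo 3)) (K.map (reflectLastDiffeo 3)) ∅}
    (ht : b.IsTransport bt) : IsFlipPair bt b :=
  ⟨ht.band_eq, ht.δ_eq⟩

namespace IsFlipPair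

variable (hP : IsFlipPair b₁ b₂)
include hP

/-- **Flip pairs are symmetric.** [folklore] -/
theorem symm : IsFlipPair b₂ b₁ := by
  refine ⟨fun x ↦ ?_, hP.δ_eq.symm⟩
  have h := hP.band_eq (pt2 1 1 - x)
  rw [sub_sub_cancel] at h
  rw [h, reflectLast_reflectLast]

/-- **The bands at opposite displacements from the centre are reflections of each other.** [folklore] -/
theorem band_centre_add (q : 𝔼 2) : b₁.band (pt2 2⁻¹ 2⁻¹ + q) = reflectLast 3 (b₂.band (pt2 2⁻¹ 2⁻¹ + -q)) := by
  rw [hP.band_eq]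
  congr 2
  ext i; fin_cases i <;> simp <;> ring

/-- The square neighbourhood is symmetric under the half-turn. [folklore] -/
theorem sub_mem_squareNhd_iff (x : 𝔼 2) : pt2 1 1 - x ∈ squareNhd b₂.δ ↔ x ∈ squareNhd b₁.δ := by
  rw [mem_squareNhd_iff, mem_squareNhd_iff, hP.δ_eq]
  refine forall_congr' fun i ↦ ?_
  have : (pt2 1 1 - x) i = 1 - x i := by fin_cases i <;> simp
  rw [this]
  constructor <;> rintro ⟨h1, h2⟩ <;> constructor <;> linarith

/-- **The normal-position hypothesis transports.** [folklore] -/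
theorem cross_eq (hcross₂ : b₂.band ⁻¹' sphereEquator 2 ∩ squareNhd b₂.δ = {x ∈ squareNhd b₂.δ | x 0 = 2⁻¹}) :
    b₁.band ⁻¹' sphereEquator 2 ∩ squareNhd b₁.δ = {x ∈ squareNhd b₁.δ | x 0 = 2⁻¹} := by
  ext x
  have hx' := hP.sub_mem_squareNhd_iff x
  have key : pt2 1 1 - x ∈ b₂.band ⁻¹' sphereEquator 2 ∩ squareNhd b₂.δ ↔ pt2 1 1 - x ∈ {x ∈ squareNhd b₂.δ | x 0 = 2⁻¹} := by
    rw [hcross₂]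
  simp only [mem_inter_iff, mem_preimage, mem_setOf_eq] at key ⊢
  rw [hP.band_eq, reflectLast_mem_sphereEquator_iff]
  have h0 : (pt2 1 1 - x) 0 = 1 - x 0 := by simp
  rw [h0, hx'] at key
  constructor
  · rintro ⟨h1, h2⟩; exact ⟨h2, by linarith [(key.1 ⟨h1, h2⟩).2]⟩
  · rintro ⟨h1, h2⟩; exact ⟨(key.2 ⟨h1, by linarith⟩).1, h1⟩

/-- **The band in the chart**: `b̃.Fband q = sphereInv (b₂.Fband (-q))` near `0`. [folklore] -/
theorem Fband_eq {hcross₂ : b₂.band ⁻¹' sphereEquator 2 ∩ squareNhd b₂.δ = {x ∈ squareNhd b₂.δ | x 0 = 2⁻¹}}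
    {hcross₁ : b₁.band ⁻¹' sphereEquator 2 ∩ squareNhd b₁.δ = {x ∈ squareNhd b₁.δ | x 0 = 2⁻¹}} {q : 𝔼 2}
    (hq : ‖q‖ < b₂.poleRad hcross₂) (hqt : ‖q‖ < b₁.poleRad hcross₁) : b₁.Fband q = sphereInv (b₂.Fband (-q)) := by
  have e : pt2 1 1 - (pt2 2⁻¹ 2⁻¹ + q) = pt2 2⁻¹ 2⁻¹ + -q := by
    ext i; fin_cases i <;> simp <;> ring
  have hN : b₂.band (pt2 2⁻¹ 2⁻¹ + -q) ≠ northPole := b₂.band_ne_northPole_of_norm_lt hcross₂ (by rwa [norm_neg])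
  have hS : reflectLast 3 (b₂.band (pt2 2⁻¹ 2⁻¹ + -q)) ≠ northPole := by
    rw [← e, ← hP.band_eq]; exact b₁.band_ne_northPole_of_norm_lt hcross₁ hqt
  rw [Fband, hP.band_eq, e, psiN_reflectLast hN hS, Fband]

/-- **The crossing points agree in the chart.** [folklore] -/
theorem pZero_eq {hcross₂ : b₂.band ⁻¹' sphereEquator 2 ∩ squareNhd b₂.δ = {x ∈ squareNhd b₂.δ | x 0 = 2⁻¹}}
    {hcross₁ : b₁.band ⁻¹' sphereEquator 2 ∩ squareNhd b₁.δ = {x ∈ squareNhd b₁.δ | x 0 = 2⁻¹}} : b₁.pZero = b₂.pZero := by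
  have h := hP.Fband_eq (hcross₂ := hcross₂) (hcross₁ := hcross₁) (q := 0) (by rw [norm_zero]; exact (b₂.poleRad_pos hcross₂).1)
    (by rw [norm_zero]; exact (b₁.poleRad_pos hcross₁).1)
  rw [neg_zero] at h
  rw [pZero, h, ← pZero, sphereInv_of_norm_eq_two (b₂.norm_pZero hcross₂)]

/-- **The derivative of the band in the chart**: `D F̃ (0) = Ref ∘ D F (0) ∘ (-id)`. [folklore] -/
theorem fderiv_Fband_eq (hcross₂ : b₂.band ⁻¹' sphereEquator 2 ∩ squareNhd b₂.δ = {x ∈ squareNhd b₂.δ | x 0 = 2⁻¹})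
    (hcross₁ : b₁.band ⁻¹' sphereEquator 2 ∩ squareNhd b₁.δ = {x ∈ squareNhd b₁.δ | x 0 = 2⁻¹}) :
    fderiv ℝ b₁.Fband 0 = (refl b₂.pZero).comp ((fderiv ℝ b₂.Fband 0).comp (-ContinuousLinearMap.id ℝ (𝔼 2))) := by
  have hr : 0 < min (b₂.poleRad hcross₂) (b₁.poleRad hcross₁) := lt_min (b₂.poleRad_pos hcross₂).1 (b₁.poleRad_pos hcross₁).1
  have hev : b₁.Fband =ᶠ[𝓝 0] fun q ↦ sphereInv (b₂.Fband (-q)) := by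
    filter_upwards [Metric.ball_mem_nhds (0 : 𝔼 2) hr] with q hq
    rw [mem_ball, dist_zero_right, lt_min_iff] at hq
    exact hP.Fband_eq hq.1 hq.2
  have h1 : HasFDerivAt (fun q : 𝔼 2 ↦ -q) (-ContinuousLinearMap.id ℝ (𝔼 2)) 0 := (hasFDerivAt_id 0).neg
  have h2 : HasFDerivAt b₂.Fband (fderiv ℝ b₂.Fband 0) (-0) := by
    rw [neg_zero]; exact (b₂.differentiableAt_Fband hcross₂ (by rw [norm_zero]; exact (b₂.poleRad_pos hcross₂).1)).hasFDerivAt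
  have h3 : HasFDerivAt sphereInv (refl b₂.pZero) (b₂.Fband (-0)) := by
    rw [neg_zero]; exact hasFDerivAt_sphereInv_refl (b₂.norm_pZero hcross₂)
  exact ((h3.comp 0 (h2.comp 0 h1)).congr_of_eventuallyEq hev).fderiv

/-- **First frame vector**: `f̃₀ = -Ref f₀`. [folklore] -/
theorem fZero_eq (hcross₂ : b₂.band ⁻¹' sphereEquator 2 ∩ squareNhd b₂.δ = {x ∈ squareNhd b₂.δ | x 0 = 2⁻¹})
    (hcross₁ : b₁.band ⁻¹' sphereEquator 2 ∩ squareNhd b₁.δ = {x ∈ squareNhd b₁.δ | x 0 = 2⁻¹}) :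
    b₁.fZero = -refl b₂.pZero b₂.fZero := by
  rw [fZero, hP.fderiv_Fband_eq hcross₂ hcross₁, fZero]
  simp

/-- **Second frame vector**: `f̃₁ = -Ref f₁`. [folklore] -/
theorem fOne_eq (hcross₂ : b₂.band ⁻¹' sphereEquator 2 ∩ squareNhd b₂.δ = {x ∈ squareNhd b₂.δ | x 0 = 2⁻¹})
    (hcross₁ : b₁.band ⁻¹' sphereEquator 2 ∩ squareNhd b₁.δ = {x ∈ squareNhd b₁.δ | x 0 = 2⁻¹}) :
    b₁.fOne = -refl b₂.pZero b₂.fOne := by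
  rw [fOne, hP.fderiv_Fband_eq hcross₂ hcross₁, fOne]
  simp

/-! ### The third frame vector and the frame relation -/

section Frame

variable (hcross₂ : b₂.band ⁻¹' sphereEquator 2 ∩ squareNhd b₂.δ = {x ∈ squareNhd b₂.δ | x 0 = 2⁻¹})
  (hcross₁ : b₁.band ⁻¹' sphereEquator 2 ∩ squareNhd b₁.δ = {x ∈ squareNhd b₁.δ | x 0 = 2⁻¹})
include hcross₂ hcross₁

/-- **The reflected third frame vector is a nonzero multiple of the transported one.** [folklore] -/
theorem exists_refl_gTwo : ∃ μ : ℝ, μ ≠ 0 ∧ refl b₂.pZero b₂.gTwo = μ • b₁.gTwo := by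
  have hp := b₂.norm_pZero hcross₂
  -- `Ref g₂ ⟂ f̃₀, f̃₁`
  have h0 : ⟪b₁.fZero, refl b₂.pZero b₂.gTwo⟫ = 0 := by
    rw [hP.fZero_eq hcross₂ hcross₁, inner_neg_left, inner_refl_refl hp, real_inner_comm, IsTransport.inner_gTwo_fZero, neg_zero]
  have h1 : ⟪b₁.fOne, refl b₂.pZero b₂.gTwo⟫ = 0 := by
    rw [hP.fOne_eq hcross₂ hcross₁, inner_neg_left, inner_refl_refl hp, real_inner_comm, IsTransport.inner_gTwo_fOne, neg_zero]
  rw [EuclideanSpace.inner_eq_star_dotProduct, star_trivial, dotProduct_comm] at h0 h1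
  obtain ⟨μ, hμ⟩ := IsTransport.exists_eq_smul_cross (b₁.cross_ne_zero hcross₁) h0 h1
  refine ⟨μ, fun hμ0 ↦ ?_, ?_⟩
  · rw [hμ0, zero_smul] at hμ
    have : refl b₂.pZero b₂.gTwo = 0 := (WithLp.ofLp_eq_zero 2).1 hμ
    exact b₂.gTwo_ne_zero hcross₂ (refl_injective hp (by rw [this, map_zero]))
  · apply (WithLp.ofLp_injective 2)
    rw [hμ, WithLp.ofLp_smul, gTwo, WithLp.ofLp_toLp]

/-- **The frame ratio** `μ` with `Ref g₂ = μ g̃₂` (chosen). [folklore] -/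
def mu : ℝ := (hP.exists_refl_gTwo hcross₂ hcross₁).choose

/-- The frame ratio is nonzero. [folklore] -/
theorem mu_ne_zero : hP.mu hcross₂ hcross₁ ≠ 0 := (hP.exists_refl_gTwo hcross₂ hcross₁).choose_spec.1

/-- `Ref g₂ = μ g̃₂`. [folklore] -/
theorem refl_gTwo : refl b₂.pZero b₂.gTwo = hP.mu hcross₂ hcross₁ • b₁.gTwo := (hP.exists_refl_gTwo hcross₂ hcross₁).choose_spec.2

/-- **The frame relation**: `Ref (frame Z) = framẽ (-Z₀, -Z₁, μ Z₂)`. [folklore] -/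
theorem refl_frame (Z : 𝔼 3) :
    refl b₂.pZero (b₂.frame hcross₂ Z) = b₁.frame hcross₁ (pt3 (-Z 0) (-Z 1) (hP.mu hcross₂ hcross₁ * Z 2)) := by
  have e0 : (pt3 (-Z 0) (-Z 1) (hP.mu hcross₂ hcross₁ * Z 2) : 𝔼 3) 0 = -Z 0 := rfl
  have e1 : (pt3 (-Z 0) (-Z 1) (hP.mu hcross₂ hcross₁ * Z 2) : 𝔼 3) 1 = -Z 1 := rfl
  have e2 : (pt3 (-Z 0) (-Z 1) (hP.mu hcross₂ hcross₁ * Z 2) : 𝔼 3) 2 = hP.mu hcross₂ hcross₁ * Z 2 := rfl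
  rw [frame_apply, frame_apply, e0, e1, e2, map_add, map_add, map_smul, map_smul, map_smul, hP.refl_gTwo hcross₂ hcross₁,
    hP.fZero_eq hcross₂ hcross₁, hP.fOne_eq hcross₂ hcross₁, smul_neg, smul_neg, neg_smul, neg_smul, neg_neg, neg_neg, smul_smul,
    mul_comm (Z 2)]

/-- **The transported blow-up of a reflected chart vector, to first order**: for `y = blowDown Z`
(so `y - pZero = κ frame Z`), `blowUp̃ (pZero + Ref (y - pZero)) = (-Z₀, -Z₁, μ Z₂)`. [folklore] -/
theorem blowUp_pZero_add_refl {κ : ℝ} (hκ : κ ≠ 0) (Z : 𝔼 3) :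
    b₁.blowUp hcross₁ κ (b₂.pZero + refl b₂.pZero (b₂.blowDown hcross₂ κ Z - b₂.pZero)) =
      pt3 (-Z 0) (-Z 1) (hP.mu hcross₂ hcross₁ * Z 2) := by
  rw [blowDown, add_sub_cancel_left, map_smul, hP.refl_frame hcross₂ hcross₁, blowUp, hP.pZero_eq (hcross₂ := hcross₂) (hcross₁ := hcross₁),
    add_sub_cancel_left, map_smul, smul_smul, inv_mul_cancel₀ hκ, one_smul, ContinuousLinearEquiv.symm_apply_apply]

/-- **The transported blow-up of an inverted point, with error**: for `‖Z‖ ≤ Zmax` and `κ` small the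
blow-up coordinates of `sphereInv (blowDown Z)` for `b̃` are within `ε` of `(-Z₀, -Z₁, μ Z₂)`
(differentiability of the inversion at `pZero`). [folklore] -/
theorem exists_blowUp_sphereInv_near {Zmax ε : ℝ} (hZ : 0 < Zmax) (hε : 0 < ε) :
    ∃ κ₁ > 0, ∀ κ, 0 < κ → κ ≤ κ₁ → ∀ Z : 𝔼 3, ‖Z‖ ≤ Zmax →
      ‖b₁.blowUp hcross₁ κ (sphereInv (b₂.blowDown hcross₂ κ Z)) - pt3 (-Z 0) (-Z 1) (hP.mu hcross₂ hcross₁ * Z 2)‖ ≤ ε := by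
  have hp := b₂.norm_pZero hcross₂
  set NF := ‖((b₂.frame hcross₂ : (𝔼 3) ≃L[ℝ] 𝔼 3) : (𝔼 3) →L[ℝ] 𝔼 3)‖
  set NG := ‖(((b₁.frame hcross₁).symm : (𝔼 3) ≃L[ℝ] 𝔼 3) : (𝔼 3) →L[ℝ] 𝔼 3)‖
  have hNF : 0 ≤ NF := norm_nonneg _
  have hNG : 0 ≤ NG := norm_nonneg _
  -- little-o form of the derivative of `sphereInv` at `pZero`
  have hder := hasFDerivAt_sphereInv_refl hp
  rw [hasFDerivAt_iff_isLittleO_nhds_zero] at hder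
  have hc : 0 < ε / ((NG + 1) * (NF + 1) * Zmax) := by positivity
  obtain ⟨δ, hδ, hδb⟩ := Metric.eventually_nhds_iff.1 (hder.def hc)
  refine ⟨δ / (2 * (NF + 1) * Zmax), by positivity, fun κ hκ hκ1 Z hZle ↦ ?_⟩
  set h : 𝔼 3 := κ • b₂.frame hcross₂ Z with hh
  have hy : b₂.blowDown hcross₂ κ Z = b₂.pZero + h := rfl
  have hnh : ‖h‖ ≤ κ * NF * Zmax := by
    rw [hh, norm_smul, Real.norm_eq_abs, abs_of_pos hκ, mul_assoc]
    refine mul_le_mul_of_nonneg_left ?_ hκ.le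
    have h1 : ‖b₂.frame hcross₂ Z‖ ≤ NF * ‖Z‖ := ((b₂.frame hcross₂ : (𝔼 3) ≃L[ℝ] 𝔼 3) : (𝔼 3) →L[ℝ] 𝔼 3).le_opNorm Z
    exact h1.trans (mul_le_mul_of_nonneg_left hZle hNF)
  have hnh' : ‖h‖ < δ := by
    have h1 : κ * NF * Zmax ≤ δ / (2 * (NF + 1) * Zmax) * NF * Zmax := by gcongr
    have h2 : δ / (2 * (NF + 1) * Zmax) * NF * Zmax < δ := by
      have : δ / (2 * (NF + 1) * Zmax) * NF * Zmax = δ * (NF / (2 * (NF + 1))) := by field_simp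
      rw [this]
      have : NF / (2 * (NF + 1)) < 1 := (div_lt_one (by positivity)).2 (by linarith)
      nlinarith
    linarith
  have hE := hδb (show dist h 0 < δ by rwa [dist_zero_right])
  -- `sphereInv (p + h) = p + Ref h + E`, `‖E‖ ≤ c ‖h‖`
  set E := sphereInv (b₂.pZero + h) - sphereInv b₂.pZero - refl b₂.pZero h with hEdef
  have hsph : sphereInv (b₂.blowDown hcross₂ κ Z) = (b₂.pZero + refl b₂.pZero (b₂.blowDown hcross₂ κ Z - b₂.pZero)) + E := by
    rw [hy, hEdef, sphereInv_of_norm_eq_two hp, add_sub_cancel_left]; abel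
  have hlin : b₁.blowUp hcross₁ κ (sphereInv (b₂.blowDown hcross₂ κ Z)) =
      pt3 (-Z 0) (-Z 1) (hP.mu hcross₂ hcross₁ * Z 2) + κ⁻¹ • (b₁.frame hcross₁).symm E := by
    rw [hsph, ← hP.blowUp_pZero_add_refl hcross₂ hcross₁ hκ.ne' Z, blowUp, blowUp]
    rw [show b₂.pZero + refl b₂.pZero (b₂.blowDown hcross₂ κ Z - b₂.pZero) + E - b₁.pZero =
      (b₂.pZero + refl b₂.pZero (b₂.blowDown hcross₂ κ Z - b₂.pZero) - b₁.pZero) + E by abel, map_add, smul_add]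
  rw [hlin, add_sub_cancel_left, norm_smul, norm_inv, Real.norm_eq_abs, abs_of_pos hκ]
  have h3 : ‖(b₁.frame hcross₁).symm E‖ ≤ NG * ‖E‖ := (((b₁.frame hcross₁).symm : (𝔼 3) ≃L[ℝ] 𝔼 3) : (𝔼 3) →L[ℝ] 𝔼 3).le_opNorm E
  have h4 : ‖E‖ ≤ ε / ((NG + 1) * (NF + 1) * Zmax) * (κ * NF * Zmax) := hE.trans (mul_le_mul_of_nonneg_left hnh hc.le)
  have h5 : κ⁻¹ * ‖(b₁.frame hcross₁).symm E‖ ≤ κ⁻¹ * (NG * (ε / ((NG + 1) * (NF + 1) * Zmax) * (κ * NF * Zmax))) := by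
    gcongr; exact h3.trans (mul_le_mul_of_nonneg_left h4 hNG)
  have h6 : κ⁻¹ * (NG * (ε / ((NG + 1) * (NF + 1) * Zmax) * (κ * NF * Zmax))) = ε * (NG / (NG + 1)) * (NF / (NF + 1)) := by
    field_simp
  have h7 : NG / (NG + 1) ≤ 1 := (div_le_one (by positivity)).2 (by linarith)
  have h8 : NF / (NF + 1) ≤ 1 := (div_le_one (by positivity)).2 (by linarith)
  have h9 : ε * (NG / (NG + 1)) * (NF / (NF + 1)) ≤ ε * (NG / (NG + 1)) * 1 :=
    mul_le_mul_of_nonneg_left h8 (by positivity)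
  have h10 : ε * (NG / (NG + 1)) ≤ ε * 1 := mul_le_mul_of_nonneg_left h7 hε.le
  linarith


/-! ### Correspondence of necks -/

/-- **`ψ⁻¹ (b₁.Fband q) = R (ψ⁻¹ (b₂.Fband (-q)))`** for `q` within both pole radii. [folklore] -/
theorem psiN_symm_Fband_eq {q : 𝔼 2} (hq : ‖q‖ < b₂.poleRad hcross₂) (hq₁ : ‖q‖ < b₁.poleRad hcross₁) :
    psiN.symm (b₁.Fband q) = reflectLast 3 (psiN.symm (b₂.Fband (-q))) := by
  have hN₁ : b₁.band (pt2 2⁻¹ 2⁻¹ + q) ≠ northPole := b₁.band_ne_northPole_of_norm_lt hcross₁ hq₁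
  have hN₂ : b₂.band (pt2 2⁻¹ 2⁻¹ + -q) ≠ northPole := b₂.band_ne_northPole_of_norm_lt hcross₂ (by rwa [norm_neg])
  rw [Fband, Fband, psiN_symm_apply_psiN hN₁, psiN_symm_apply_psiN hN₂, hP.band_centre_add]

/-- **The lower neck of `b₁` at level `α` is the reflected upper neck of `b₂` at level `-α`**
(`κ (|α| + 1)` within both pole radii). [folklore] -/
theorem psiN_symm_railLoPsi_eq {κ α : ℝ} (hκ : 0 < κ) (hq : κ * (|α| + 1) < b₂.poleRad hcross₂)
    (hq₁ : κ * (|α| + 1) < b₁.poleRad hcross₁) :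
    psiN.symm (b₁.railLoPsi κ α) = reflectLast 3 (psiN.symm (b₂.railHiPsi κ (-α))) := by
  have hn : ‖(pt2 (κ * α) (-κ) : 𝔼 2)‖ < b₂.poleRad hcross₂ := norm_railLoParam_lt hκ hq
  have hn₁ : ‖(pt2 (κ * α) (-κ) : 𝔼 2)‖ < b₁.poleRad hcross₁ := norm_railLoParam_lt hκ hq₁
  have e : (pt2 (κ * -α) κ : 𝔼 2) = -pt2 (κ * α) (-κ) := by
    ext i; fin_cases i <;> simp
  rw [railLoPsi, railHiPsi, e]
  exact hP.psiN_symm_Fband_eq hcross₂ hcross₁ hn hn₁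

/-- **The upper neck of `b₁` at level `α` is the reflected lower neck of `b₂` at level `-α`.**
[folklore] -/
theorem psiN_symm_railHiPsi_eq {κ α : ℝ} (hκ : 0 < κ) (hq : κ * (|α| + 1) < b₂.poleRad hcross₂)
    (hq₁ : κ * (|α| + 1) < b₁.poleRad hcross₁) :
    psiN.symm (b₁.railHiPsi κ α) = reflectLast 3 (psiN.symm (b₂.railLoPsi κ (-α))) := by
  have hn : ‖(pt2 (κ * α) κ : 𝔼 2)‖ < b₂.poleRad hcross₂ := norm_railHiParam_lt hκ hq
  have hn₁ : ‖(pt2 (κ * α) κ : 𝔼 2)‖ < b₁.poleRad hcross₁ := norm_railHiParam_lt hκ hq₁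
  have e : (pt2 (κ * -α) (-κ) : 𝔼 2) = -pt2 (κ * α) κ := by
    ext i; fin_cases i <;> simp
  rw [railLoPsi, railHiPsi, e]
  exact hP.psiN_symm_Fband_eq hcross₂ hcross₁ hn hn₁

/-- **Coerced form of the neck correspondence** (lower neck of `b₁`). [folklore] -/
theorem coe_psiN_symm_railLoPsi_eq {κ α : ℝ} (hκ : 0 < κ) (hq : κ * (|α| + 1) < b₂.poleRad hcross₂)
    (hq₁ : κ * (|α| + 1) < b₁.poleRad hcross₁) :
    ((psiN.symm (b₁.railLoPsi κ α) : 𝕊 3) : 𝔼 4) = ((reflectLast 3 (psiN.symm (b₂.railHiPsi κ (-α))) : 𝕊 3) : 𝔼 4) := by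
  rw [hP.psiN_symm_railLoPsi_eq hcross₂ hcross₁ hκ hq hq₁]

/-- **Coerced form of the neck correspondence** (upper neck of `b₁`). [folklore] -/
theorem coe_psiN_symm_railHiPsi_eq {κ α : ℝ} (hκ : 0 < κ) (hq : κ * (|α| + 1) < b₂.poleRad hcross₂)
    (hq₁ : κ * (|α| + 1) < b₁.poleRad hcross₁) :
    ((psiN.symm (b₁.railHiPsi κ α) : 𝕊 3) : 𝔼 4) = ((reflectLast 3 (psiN.symm (b₂.railLoPsi κ (-α))) : 𝕊 3) : 𝔼 4) := by
  rw [hP.psiN_symm_railHiPsi_eq hcross₂ hcross₁ hκ hq hq₁]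

end Frame

end IsFlipPair

end BandData

end Literature.Topology.FourManifolds
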